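import Summits.HodgeConjecture.HodgeConjecture.Theorems.F0P3cStCharTSLdsRedTwoOfReducible   -- ★ «LDS-RED-TWO» (F0P2-p06): brings ★ PS-UNITARY, ★ N1∕N2∕N3 holds, ★ Frobenius uniqueness, ★ UniqPar `isConstituentOf_iff_of_ne`, ★ `finrank_coinvariants_eq_one_of_ne_bot_of_ne_top`
import Summits.HodgeConjecture.HodgeConjecture.Theorems.F0P3KeysLabelledPair              -- ★ stub S2 road (case (2)): brings ★ `IrrClass.labelledPair_exists_of_line_abs`, ★ `isLimitOfCompactOpen_cmUnipotentU`, ★ `deltaChar_cmBorel_eq_one`, ★ `isAdmissible_cmPrincipalSeries`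
import Summits.HodgeConjecture.HodgeConjecture.Theorems.R90S1WeylFixedTorusCharUnitary    -- ★ p861507 (R90-C10-p08 (g0), file U): `norm_cmTorusCharPair_eq_one_of_cmWeylTorusCharPair_eq` (`wχ = χ ⇒ |χ| = 1`)
import HarnessLib

/-!
# R90 · S1 — §12.2 [BZ] «if `i_G(χ)` is reducible, it contains exactly two irreducible constituents» (socket A2b `stub_R90_122_bz_twoConstituents`, PROVED)

Cell `pub/hodgecm-mathlib`, crux H413 = `stmt-HodgeConjecture-24833` (lane `--supports … --as helper`), SLAB R90-TF, section S1 «Ch. 12 local»; prover seat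
`hodgecm-mathlib-R90-C10-p06` (g0), socket S1#2 = A2b of `Cruxes/H413/Lines/R90_S1_NonsplitLocalPacketsA.lean` dealt by R90-C10-plan (EMIT S1 WAVE 1,
2026-09-04T15:32:01Z).  THEOREMS ONLY (no definition ∕ instance ∕ notation ∕ named fact ∕ `sorry`); ★-only imports (no `Cruxes` import: the socket's datum
`datum_S1ns L v χ₁ χ₂` is ★ `cmPrincipalSeries L 3 v (cmTorusCharPair L v χ₁ χ₂)` by `rfl`, so ED. 2 pays the stub by `exact bz_twoConstituents L v hns χ₁ χ₂ h1c h2c hred`).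

THE STATEMENT (print [Rogawski1990, §12.2 p. 173]: «If `i_G(χ)` is reducible, it contains exactly two irreducible constituents ([BZ]).»).  At a NON-SPLIT finite place `v`
of `L⁺`, `G = U(Φ₃)(L⁺_v) = Gqs L v`, `χ = (χ₁, χ₂)` CONTINUOUS characters of `E_w^×` and `E¹_w` (★ `cmTorusCharPair`): if `i_G(χ)` has a `G`-stable `⊥ ≠ N ≠ ⊤`, then there are
classes `c ≠ c'` such that the constituents of `i_G(χ)` (★ `IrrClass.IsConstituentOf`) are EXACTLY `c, c'`.

THE PROOF — in every case, WITHOUT Keys' list (so the planner's «honest residue» of ROAD α, case (3) `wχ = χ`, is discharged here, by unitarity instead of Whittaker models).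
Split on `wχ = χ` (★ `cmWeylTorusCharPair L v χ₁ χ₂ = cmTorusCharPair L v χ₁ χ₂`, `w(χ₁, χ₂) = (χ̄₁⁻¹, χ₂)`).
* `wχ ≠ χ` (Keys' cases (1), (2)): the two constituents `⟦N⟧`, `⟦i_G(χ)⁄N⟧` (★ N3 «no 3-chain» ⇒ both irreducible) have normalised Jacquet modules the two DISTINCT characters
  `χ`, `wχ` of the filtration `0 → wχ → r_B i_G(χ) → χ → 0` (★ N1), both non-zero by Frobenius (★ N2 + ★ `nontrivial_coinvariants_of_injective_normalizedInd`), hence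
  `⟦N⟧ ≠ ⟦i_G(χ)⁄N⟧` — ONE call of the ★ package `IrrClass.labelledPair_exists_of_line_abs` [Casselman1995, §7.1], verbatim the road of ★ `F0P3KeysLabelledPair.labelledPair_of_reducible`
  (there at `χ = χ_ξ`), which also returns the exhaustion clause.
* `wχ = χ` (⊇ Keys' case (3)): then `|χ(t)| = 1` for every `t` (★ `norm_cmTorusCharPair_eq_one_of_cmWeylTorusCharPair_eq`, R90-C10-p08's file U: `χ₁(α)χ₁(ᾱ) = 1` and
  `E¹_w` compact at a non-split `v`), so `i_G(χ)` is COMPLETELY REDUCIBLE (★ «PS-UNITARY★» `isSemisimpleRepresentation_cmPrincipalSeries`, the invariant inner product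
  `∫_{K_v} conj(f₁) f₂` [BernsteinZelevinsky1976, 2.25 (c)]).  Then `N` has an invariant complement
  `N'`, both irreducible (★ N3), and `⟦N⟧ ≠ ⟦N'⟧`: an equivalence `N ≃ N'` would be a SECOND embedding `N ↪ i_G(χ)` not proportional to the inclusion, against Frobenius
  uniqueness on the LINE `r_B(N)` (★ `finrank_coinvariants_eq_one_of_ne_bot_of_ne_top` [Casselman1995, Prop. 7.1.3], ★ `intertwiningMap_cmPrincipalSeries_eq_smul`
  [BernsteinZelevinsky1977, Prop. 1.9 (b)]) — the argument of ★ `F0P3cStCharTSLdsRedTwoOfReducible.two_constituents_of_reducible` (there under `χ₁|_{F^×} = 1`), run here under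
  `|χ| = 1`.  Exhaustion: two distinct constituents exhaust `JH(i_G(χ))` (★ `F0P3cStCharTSUniqPar.isConstituentOf_iff_of_ne`).
* §1 (private) `two_constituents_of_reducible_of_norm_eq_one` (the unitary road at `|χ| = 1`).  §2 **`bz_twoConstituents`** — the ONE public theorem: socket A2b,
  token for token over ★ currency.
HONEST LABEL: HC_CM is proved only modulo the 7 printed citations (2 remaining named inputs: hLiu418 = `stmt-HodgeConjecture-24832`, h413 = `stmt-HodgeConjecture-24833`) until
rung 0 closes; this file pays ONE S1 socket (A2b) unconditionally and closes no organ by itself.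

## References
* [Rogawski1990] J. D. Rogawski, *Automorphic Representations of Unitary Groups in Three Variables*, Ann. of Math. Stud. 123 (1990), §12.1 p. 171; §12.2 p. 173 ll. 8–12, (3) pp. 173–174.
* [BernsteinZelevinsky1977] I. N. Bernstein, A. V. Zelevinsky, *Induced representations of reductive p-adic groups I*, Ann. Sci. ÉNS 10 (1977), Prop. 1.9 (b), Thm. 2.8, Cor. 2.13 (c).
* [BernsteinZelevinsky1976] I. N. Bernstein, A. V. Zelevinsky, Russian Math. Surveys 31:3 (1976), 2.25 (c).
* [Casselman1995] W. Casselman, *Introduction to the theory of admissible representations of p-adic reductive groups* (1995), Thm. 3.2.4, Cor. 6.3.9 (b), L. 7.1.1 (a), Cor. 7.1.2, Prop. 7.1.3.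
* [Keys1984] D. Keys, *Principal series representations of special unitary groups over local fields*, Compositio Math. 51 (1984), §7 Thm. p. 126.
-/

set_option autoImplicit false
-- the mandated namespace has the single-problem summit's repeated segment (`HodgeConjecture.HodgeConjecture`)
set_option linter.dupNamespace false

noncomputable section

open NumberField IsDedekindDomain
open scoped Matrix

open Literature.NumberTheory.Rogawski1990 Literature.NumberTheory.Automorphic Literature.NumberTheory.Automorphic.UnitaryGroup
open Literature.RepresentationTheory.FiniteGroups
open Summit.HodgeConjecture.HodgeConjecture.Cruxes.H413

namespace Summit.HodgeConjecture.HodgeConjecture.R90.S1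

variable (L : Type) [Field L] [NumberField L] [IsCMField L] (v : HeightOneSpectrum (𝓞 ↥(maximalRealSubfield L)))
  (hns : ∀ w : PlacesOver L v, IsCMField.complexConj L • w.1 = w.1)

/-! ## §1 The unitary road (`|χ| = 1`): a reducible `i_G(χ)` has two NON-ISOMORPHIC constituents (private helper) -/

include hns in
set_option synthInstance.maxHeartbeats 400000 in
set_option maxHeartbeats 8000000 in
-- statement∕proof-heavy: the `SmoothInd` carrier of `cmPrincipalSeries`, its subrepresentations and their Jacquet modules (class of ★ LdsRedTwoOfReducible §2)
/-- **A reducible UNITARY `i_G(χ₁, χ₂)` has two DISTINCT constituents.**  At a non-split `v`, for continuous `χ₁, χ₂` with `|χ(t)| = 1` for all `t` (`χ = (χ₁, χ₂)`): if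
`i_G(χ)` has a `G`-stable `⊥ ≠ N ≠ ⊤`, then it has constituents `c₁ ≠ c₂` — `⟦N⟧` and `⟦N'⟧` for the invariant complement `N'` of the semisimple `i_G(χ)` (★ «PS-UNITARY★»
`isSemisimpleRepresentation_cmPrincipalSeries`), both irreducible (★ N3), NON-ISOMORPHIC by Frobenius uniqueness on the line `r_B(N)` (★ [Casselman1995, Prop. 7.1.3]): two
proportional embeddings `N ↪ i_G(χ)` cannot land in the complementary `N` and `N'`.  (The proof of ★ `F0P3cStCharTSLdsRedTwoOfReducible.two_constituents_of_reducible`,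
with its semisimplicity input generalised from `χ₁|_{F^×} = 1` to `|χ| = 1`.)
[cite: Rogawski1990, §12.2 p. 173 ll. 8–12; §12.2 (3) pp. 173–174] [cite: Casselman1995, Prop. 7.1.3 p. 67] [cite: BernsteinZelevinsky1977, Prop. 1.9 (b)] [cite: BernsteinZelevinsky1976, 2.25 (c)] -/
private theorem two_constituents_of_reducible_of_norm_eq_one
    (χ₁ : (LocalRing L v)ˣ →* ℂˣ) (χ₂ : ↥(normOneUnits (conjLocal L (IsCMField.complexConj L) v)) →* ℂˣ)
    (h1 : Continuous (fun x => ((χ₁ x : ℂˣ) : ℂ))) (h2 : Continuous (fun x => ((χ₂ x : ℂˣ) : ℂ)))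
    (hχu : ∀ t, ‖((cmTorusCharPair L v χ₁ χ₂ t : ℂˣ) : ℂ)‖ = 1)
    (hred : ∃ N : Subrepresentation (cmPrincipalSeries L 3 v (cmTorusCharPair L v χ₁ χ₂)), N ≠ ⊥ ∧ N ≠ ⊤) :
    ∃ c₁ c₂ : IrrClass (Gqs L v), c₁ ≠ c₂ ∧ c₁.IsConstituentOf (cmPrincipalSeries L 3 v (cmTorusCharPair L v χ₁ χ₂)) ∧
      c₂.IsConstituentOf (cmPrincipalSeries L 3 v (cmTorusCharPair L v χ₁ χ₂)) := by
  haveI := locallyCompactSpace_cmBorelU L 3 v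
  obtain ⟨N, hNb, hNt⟩ := hred
  -- (U) complete reducibility ⇒ an invariant complement `N'`, again `⊥ ≠ N' ≠ ⊤`
  haveI := F0P3cStCharTSPrincipalSeriesUnitary.isSemisimpleRepresentation_cmPrincipalSeries L 3 v (cmTorusCharPair L v χ₁ χ₂) hχu
  obtain ⟨N', hc⟩ := exists_isCompl N
  have hN'b : N' ≠ ⊥ := fun h => hNt (eq_top_of_isCompl_bot (h ▸ hc))
  have hN't : N' ≠ ⊤ := fun h => hNb (eq_bot_of_isCompl_top (h ▸ hc))
  -- no 3-chain ⇒ `N`, `N'` irreducible; smoothness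
  have hlen := F0P3U3PrincipalSeriesLettersHold.u3PrincipalSeriesLengthLeTwo_holds L v hns χ₁ χ₂ h1 h2
  have hsm := F0P3U3LengthLeTwoOfEmbeds.isSmooth_cmPrincipalSeries L v (cmTorusCharPair L v χ₁ χ₂)
  have hNirr := IrrClass.isIrreducible_toRepresentation_of_forall_not_lt_lt hlen hNb hNt
  have hN'irr := IrrClass.isIrreducible_toRepresentation_of_forall_not_lt_lt hlen hN'b hN't
  let r₁ : SmoothIrrep (Gqs L v) := SmoothIrrep.mk ↥N.toSubmodule N.toRepresentation hNirr (hsm.toRepresentation N)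
  let r₂ : SmoothIrrep (Gqs L v) := SmoothIrrep.mk ↥N'.toSubmodule N'.toRepresentation hN'irr (hsm.toRepresentation N')
  refine ⟨IrrClass.mk r₁, IrrClass.mk r₂, ?_, (IrrClass.isConstituentOf_mk_self r₁).of_subrepresentation N,
    (IrrClass.isConstituentOf_mk_self r₂).of_subrepresentation N'⟩
  intro heq
  obtain ⟨e⟩ := (IrrClass.mk_eq_mk_iff r₁ r₂).1 heq
  -- `dim r_B(N) = 1` [Casselman1995, Prop. 7.1.3]: ★ N1 (`dim r_B(I) = 2`), ★ N2 (constituents have `r_B ≠ 0`), exactness (★ `isLimitOfCompactOpen_cmUnipotentU`)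
  have key := finiteDimensional_finrank_eq_two_of_U3PrincipalSeriesJacquetFiltration L
    (F0P3U3PrincipalSeriesJacquetFiltrationHolds.U3PrincipalSeriesJacquetFiltration_holds L) v hns χ₁ χ₂ h1 h2
  haveI := key.1
  have hfin : Module.finrank ℂ ((cmBorelTriple L 3 v).restrict N.toRepresentation).Coinvariants = 1 :=
    Representation.finrank_coinvariants_eq_one_of_ne_bot_of_ne_top (cmBorelTriple L 3 v)
      (F0P3UnipotentLimitCompactOpen.isLimitOfCompactOpen_cmUnipotentU L v) hsm
      (F0P3U3LengthLeTwoOfEmbeds.nontrivial_coinvariants_of_isConstituentOf_cmPrincipalSeries L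
        (F0P3U3PrincipalSeriesLettersHold.u3PrincipalSeriesConstituentEmbeds_holds L) v hns χ₁ χ₂ h1 h2)
      key.2 hNb hNt
  -- Frobenius uniqueness on `N`: any two `G`-maps `N → i_G(χ)` are proportional
  have huniq : ∀ ψ₁ ψ₂ : (N.toRepresentation.normalizedJacquet (cmBorelTriple L 3 v)).IntertwiningMap
      ((Representation.trivial ℂ ↥(cmBorelTriple L 3 v).M ℂ).twist (cmTorusCharPair L v χ₁ χ₂)), ψ₁ ≠ 0 → ∃ c : ℂ, ψ₂ = c • ψ₁ :=
    fun ψ₁ ψ₂ hψ₁ => F0P3cStCharTSLdsRedTwoOfReducible.intertwiningMap_eq_smul_of_finrank_eq_one _ hfin _ ψ₁ ψ₂ hψ₁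
  let B₁ : N.toRepresentation.IntertwiningMap (cmPrincipalSeries L 3 v (cmTorusCharPair L v χ₁ χ₂)) := Subrepresentation.subtypeIntertwiningMap N
  let B₂ : N.toRepresentation.IntertwiningMap (cmPrincipalSeries L 3 v (cmTorusCharPair L v χ₁ χ₂)) :=
    (Subrepresentation.subtypeIntertwiningMap N').comp e.toIntertwiningMap
  have hB₁ : B₁ ≠ 0 := Subrepresentation.subtypeIntertwiningMap_ne_zero hNb
  obtain ⟨c, hcB⟩ := F0P2pCmPrincipalSeriesInterface.intertwiningMap_cmPrincipalSeries_eq_smul L v (cmTorusCharPair L v χ₁ χ₂)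
    N.toRepresentation (hsm.toRepresentation N) huniq B₁ B₂ hB₁
  -- the contradiction: for `0 ≠ n ∈ N`, `e n = c • n ∈ N ⊓ N' = ⊥`, so `e n = 0` with `e` injective
  have hNb' : N.toSubmodule ≠ ⊥ := fun h => hNb (Subrepresentation.toSubmodule_injective h)
  obtain ⟨n, hnN, hn0⟩ := Submodule.exists_mem_ne_zero_of_ne_bot hNb'
  -- read the proportionality at `⟨n, hnN⟩`: `B₂ ⟨n, hnN⟩ = ↑(e ⟨n, hnN⟩)` and `B₁ ⟨n, hnN⟩ = n` (definitional)
  have hval : ((e.toIntertwiningMap ⟨n, hnN⟩ : ↥N'.toSubmodule) : Representation.SmoothInd (cmBorelTriple L 3 v).P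
      (Representation.twist (((Representation.trivial ℂ ↥(torusU (conjLocal L (IsCMField.complexConj L) v) (cmLocalForm L 3 v)) ℂ).twist
        (cmTorusCharPair L v χ₁ χ₂)).comp (cmBorelTriple L 3 v).proj) (rootDeltaChar (cmBorelTriple L 3 v).P))) = c • n :=
    congrArg (fun B : N.toRepresentation.IntertwiningMap (cmPrincipalSeries L 3 v (cmTorusCharPair L v χ₁ χ₂)) => B ⟨n, hnN⟩) hcB
  have hmemN : ((e.toIntertwiningMap ⟨n, hnN⟩ : ↥N'.toSubmodule) : Representation.SmoothInd (cmBorelTriple L 3 v).P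
      (Representation.twist (((Representation.trivial ℂ ↥(torusU (conjLocal L (IsCMField.complexConj L) v) (cmLocalForm L 3 v)) ℂ).twist
        (cmTorusCharPair L v χ₁ χ₂)).comp (cmBorelTriple L 3 v).proj) (rootDeltaChar (cmBorelTriple L 3 v).P))) ∈ N := by
    rw [hval]
    exact N.toSubmodule.smul_mem c hnN
  have hmem : ((e.toIntertwiningMap ⟨n, hnN⟩ : ↥N'.toSubmodule) : Representation.SmoothInd (cmBorelTriple L 3 v).P
      (Representation.twist (((Representation.trivial ℂ ↥(torusU (conjLocal L (IsCMField.complexConj L) v) (cmLocalForm L 3 v)) ℂ).twist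
        (cmTorusCharPair L v χ₁ χ₂)).comp (cmBorelTriple L 3 v).proj) (rootDeltaChar (cmBorelTriple L 3 v).P))) ∈
      (N ⊓ N' : Subrepresentation (cmPrincipalSeries L 3 v (cmTorusCharPair L v χ₁ χ₂))) :=
    ⟨hmemN, (e.toIntertwiningMap ⟨n, hnN⟩).2⟩
  rw [disjoint_iff.1 hc.disjoint] at hmem
  have hmem' : ((e.toIntertwiningMap ⟨n, hnN⟩ : ↥N'.toSubmodule) : Representation.SmoothInd (cmBorelTriple L 3 v).P
      (Representation.twist (((Representation.trivial ℂ ↥(torusU (conjLocal L (IsCMField.complexConj L) v) (cmLocalForm L 3 v)) ℂ).twist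
        (cmTorusCharPair L v χ₁ χ₂)).comp (cmBorelTriple L 3 v).proj) (rootDeltaChar (cmBorelTriple L 3 v).P))) ∈
      (⊥ : Subrepresentation (cmPrincipalSeries L 3 v (cmTorusCharPair L v χ₁ χ₂))).toSubmodule := hmem
  have hy0 : e.toIntertwiningMap ⟨n, hnN⟩ = 0 := Subtype.ext ((Submodule.mem_bot ℂ).1 hmem')
  have hinj : Function.Injective e.toIntertwiningMap := e.toLinearEquiv.injective
  have hn : (⟨n, hnN⟩ : ↥N.toSubmodule) = 0 := hinj (hy0.trans (map_zero _).symm)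
  exact hn0 (congrArg Subtype.val hn)

/-! ## §2 Socket A2b: «if `i_G(χ)` is reducible, it contains exactly two irreducible constituents ([BZ])» -/

include hns in
set_option synthInstance.maxHeartbeats 400000 in
set_option maxHeartbeats 100000000 in
-- definitional bookkeeping between the cited statements' elaborations of the CM carrier (class of ★ KeysLabelledPair §2: ONE generic call, `cases`∕projections only)
/-- **SOCKET A2b `stub_R90_122_bz_twoConstituents` — [BZ] «if `i_G(χ)` is reducible, it contains exactly two irreducible constituents»**, at a NON-SPLIT finite place `v` of
`L⁺`, for CONTINUOUS `χ = (χ₁, χ₂)` (★ `cmTorusCharPair`; the socket's `datum_S1ns L v χ₁ χ₂` is this `cmPrincipalSeries` by `rfl`): a `G`-stable `⊥ ≠ N ≠ ⊤` of `i_G(χ)`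
yields classes `c ≠ c'` with `d` a constituent of `i_G(χ)` iff `d = c ∨ d = c'`.  Case `wχ ≠ χ`: the ★ labelled-pair package [Casselman1995, §7.1] (distinct Jacquet characters `χ ≠ wχ`);
case `wχ = χ`: `|χ| = 1` (★ file U), complete reducibility + Frobenius uniqueness (§1), exhaustion ★ `isConstituentOf_iff_of_ne`.  No input from Keys' list, no Whittaker model.
[cite: Rogawski1990, §12.2 p. 173] [cite: BernsteinZelevinsky1977, Thm. 2.8, Cor. 2.13 (c), Prop. 1.9 (b)] [cite: Casselman1995, L. 7.1.1 (a), Cor. 7.1.2, Prop. 7.1.3, Cor. 6.3.9 (b)] -/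
theorem bz_twoConstituents
    (χ₁ : (LocalRing L v)ˣ →* ℂˣ) (χ₂ : ↥(normOneUnits (conjLocal L (IsCMField.complexConj L) v)) →* ℂˣ)
    (h1c : Continuous fun x => ((χ₁ x : ℂˣ) : ℂ)) (h2c : Continuous fun x => ((χ₂ x : ℂˣ) : ℂ))
    (hred : ∃ N : Subrepresentation (cmPrincipalSeries L 3 v (cmTorusCharPair L v χ₁ χ₂)), N ≠ ⊥ ∧ N ≠ ⊤) :
    ∃ c c' : IrrClass (Gqs L v), c ≠ c' ∧
      ∀ d : IrrClass (Gqs L v), d.IsConstituentOf (cmPrincipalSeries L 3 v (cmTorusCharPair L v χ₁ χ₂)) ↔ (d = c ∨ d = c') := by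
  by_cases hw : cmWeylTorusCharPair L v χ₁ χ₂ = cmTorusCharPair L v χ₁ χ₂
  · -- `wχ = χ`: the unitary road
    have hχu := norm_cmTorusCharPair_eq_one_of_cmWeylTorusCharPair_eq L v hns χ₁ χ₂ h1c h2c hw
    have H := two_constituents_of_reducible_of_norm_eq_one L v hns χ₁ χ₂ h1c h2c hχu hred
    cases H with
    | intro c₁ H₁ =>
    cases H₁ with
    | intro c₂ H₂ =>
    exact ⟨c₁, c₂, H₂.1, F0P3cStCharTSUniqPar.isConstituentOf_iff_of_ne L v hns χ₁ χ₂ h1c h2c c₁ c₂ H₂.2.1 H₂.2.2 H₂.1⟩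
  · -- `wχ ≠ χ`: the labelled pair of [Casselman1995, §7.1] (ONE generic call, master copy = N1's line data)
    haveI := locallyCompactSpace_cmBorelU L 3 v
    cases hred with
    | intro N hN' =>
    have hlen := F0P3U3PrincipalSeriesLettersHold.u3PrincipalSeriesLengthLeTwo_holds L v hns χ₁ χ₂ h1c h2c
    have hemb := F0P3U3PrincipalSeriesLettersHold.u3PrincipalSeriesConstituentEmbeds_holds L v hns χ₁ χ₂ h1c h2c
    have h1 := F0P3U3PrincipalSeriesJacquetFiltrationHolds.U3PrincipalSeriesJacquetFiltration_holds L v hns χ₁ χ₂ h1c h2c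
    have hIsm := (F0P3XiUnramNonsplitInstance.isAdmissible_cmPrincipalSeries L v (cmTorusCharPair L v χ₁ χ₂)).isSmooth
    cases h1 with
    | intro hfd hrest =>
    cases hrest with
    | intro h2 hrest' =>
    cases hrest' with
    | intro ℓ hℓ' =>
    have H := IrrClass.labelledPair_exists_of_line_abs hfd h2 ℓ hℓ'.1 hℓ'.2.1 hℓ'.2.2
      (F0P3UnipotentLimitCompactOpen.isLimitOfCompactOpen_cmUnipotentU L v)
      (F0P2nBorelCharactersUnipotent.deltaChar_cmBorel_eq_one L v) (Representation.Equiv.refl _) hIsm N hN'.1 hN'.2 hlen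
      hw hemb (Representation.Equiv.refl _)
    cases H with
    | intro πs H₁ =>
    cases H₁ with
    | intro πn H₂ =>
    exact ⟨πn, πs, fun h => H₂.1 h.symm, H₂.2.1⟩

end Summit.HodgeConjecture.HodgeConjecture.R90.S1

end
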